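import Literature.NumberTheory.EllipticCurves.Kim2026.ShaLengthRankZeroUpperBound
import Literature.NumberTheory.EllipticCurves.KuriharaNumberInvariants
import HarnessLib

/-!
# Kim 2026, Thm. 1.8 (6) in analytic rank `0`: the upper bound `length Ш(E/ℚ)[p^∞] ≤ ord_p(L(E,1)/Ω⁺_E) − m` from the `p^m`-DIVISIBILITY OF ALL KURIHARA NUMBERS (named fact)

Topic `NumberTheory/EllipticCurves`, sub-directory `Kim2026` (author–year; namespace = path,
`Literature.NumberTheory.EllipticCurves.Kim2026`). ONE named fact (`def … : Prop`, D-0014), weaker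
than print, and two proved API theorems. Sibling of
`Kim2026.rankZero_padicValNat_sha_le_of_maninConstant` (file `ShaLengthRankZeroUpperBound`: the
certificate-free inequality `length Ш[p^∞] ≤ ∂^{(0)}(δ̃)`, i.e. the case `m = 0` of the present
fact — see `rankZero_padicValNat_sha_le_of_kuriharaDivisibilityBound` below) and of the four
unit-Kurihara-number EQUALITY shapes of `KuriharaNumberKimShaLength`. Where those read clause (6)
`length_{ℤ_p} Ш(E/ℚ)[p^∞] = ∂^{(0)}(δ̃) − ∂^{(∞)}(δ̃)` with `∂^{(∞)}(δ̃) = 0` WITNESSED by one unit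
Kurihara number (an ∃-certificate), the present fact reads it with `∂^{(∞)}(δ̃) ≥ m` — by Kim's
Definition §1.5.1 a UNIVERSAL divisibility of the whole collection `{δ̃_n^{(k)}}` by `p^{min(m,k)}`
— as the hypothesis, and `length_{ℤ_p} Ш(E/ℚ)[p^∞] ≤ ∂^{(0)}(δ̃) − m` as the conclusion. (The
∃-certificate LOWER-bound direction of the same clause, "one `δ̃_n^{(k)} ≠ 0` ⇒
`length Ш[p^∞] ≥ ∂^{(0)} − (k−1)`", is the business of the sibling `ShaLengthRankZeroLowerBound`
filed by the residual cell's team n1011; the two directions share the binder family and are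
logically independent.) Written for the residual cell `b2b-bsdres` (harvest seat 2, GEN 30, item
E67 = seat additive-p4's REQUESTS R17 (a), design note `V26-DESIGN.md`): the consumer composes it
with a Tamagawa-divisibility input for the Kurihara numbers (Kim's Conjecture 1.10 direction
`∂^{(∞)}(δ̃) ≥ …`, NOT typed here and NOT a theorem in print — see "What is NOT here").

## The printed statements (C.-H. Kim, *The structure of Selmer groups and the Iwasawa main
conjecture for elliptic curves*, Amer. J. Math. 148 (2026), no. 1, 79–129 = arXiv:2203.12159; held
text = arXiv v3/v4, whose Thm. 1.9 is **Thm. 1.8** of the journal version, statement byte-identical —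
see the NUMBERING NOTE of `KuriharaNumberKimStructure`; "PDF p." = page of the v4 PDF, "p00NN" =
chunk of the store copy `paper:arxiv-2203.12159`)

* §1.2.2 (PDF p. 5, p0005 L24–33): "Let `k ≥ 1` be an integer. Let
  `𝒫_k = {ℓ, a prime : (ℓ, Np) = 1, ℓ ≡ 1 (mod p^k), a_ℓ(E) ≡ ℓ + 1 (mod p^k)}` and `𝒩_k` the set
  of square-free products of primes in `𝒫_k`. Write `I_ℓ = (ℓ − 1, a_ℓ − ℓ − 1)ℤ_p ⊆ ℤ_p` and
  `I_n = ∑_{ℓ∣n} I_ℓ ⊆ ℤ_p`" (tree: `Kato.IsKolyvaginPrime W p k ℓ`, `Kato.IsKolyvaginProduct W p k n`,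
  file `KatoKolyvaginPrimes`; `1 ∈ 𝒩_k` by convention, §1.4.2).
* §1.4.1 (PDF p. 7): "Let `p ≥ 5` be a prime and `E` an elliptic curve over `ℚ` such that the
  residual representation `ρ̄` is irreducible and the Manin constant is prime to `p`. … the real
  Néron period `Ω⁺_E` of `E` is taken as the absolute value of the integral of an invariant
  differential of a global minimal Weierstrass model of `E` over `E(ℝ)`. … Under our assumptions, we
  have `[r]⁺ ∈ ℤ_(p)`"; §1.4.3: "`δ̃_n = ∑_{a∈(ℤ/nℤ)ˣ} \overline{[a/n]⁺}·∏_{ℓ∣n} \overline{log_{η_ℓ}(a)}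
  ∈ ℤ_p/I_nℤ_p` … When `n = 1`, we have `δ̃_1 = [0]⁺ = L(E,1)/Ω⁺_E ∈ ℤ_(p)`"; §1.4.4:
  "`ord(δ̃) = min{ν(n) : n ∈ 𝒩_1, δ̃_n ≠ 0}`" (so `ord(δ̃) = 0` when `L(E,1) ≠ 0`).
* **§1.5.1** (PDF p. 7, p0007 L70–82): "Denote by `∂^{(0)}(δ̃)` the `p`-adic valuation of `δ̃_1`, and
  write `δ̃^{(k)}_n = δ̃_n mod p^k ∈ ℤ/p^kℤ` where `n ∈ 𝒩_k`. For `i ∈ ℤ_{>0}`, we also define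
  `∂^{(i)}(δ̃^{(k)}) = min{j : δ̃^{(k)}_n ∈ p^j ℤ/p^kℤ for every n ∈ 𝒩_k with ν(n) = i}` and
  `∂^{(i)}(δ̃) = min{j : δ̃_n ∈ p^j ℤ_p/I_nℤ_p for every n ∈ 𝒩_1 with ν(n) = i} = lim_{k→∞} ∂^{(i)}(δ̃^{(k)})`.
  Note that `lim_{k→∞} ∂^{(i)}(δ̃^{(k)})` is well-defined under our running hypotheses. We also write
  `∂^{(∞)}(δ̃) = min{∂^{(i)}(δ̃) : 0 ≤ i}`." — `∂^{(i)}(δ̃^{(k)})` is the largest exponent `j ≤ k` of a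
  power of `p` dividing EVERY `δ̃_n^{(k)}` with `ν(n) = i` (the `p`-divisibility shared by the whole
  collection at `ν = i`; §1.5.2: "each `i`-th higher Fitting ideal can be approximated by computing
  the valuations of `δ̃_n`'s with fixed `ν(n) = i`"), so that: if `δ̃^{(k)}_n ∈ p^{min(m,k)}ℤ/p^kℤ` for
  every `k ≥ 1` and every `n ∈ 𝒩_k`, then `∂^{(i)}(δ̃^{(k)}) ≥ min(m,k)` for all `i ≥ 1`, `k ≥ 1`, hence
  `∂^{(i)}(δ̃) ≥ m` for all `i ≥ 1`; and (`n = 1 ∈ 𝒩_k` for every `k`) `δ̃_1 ∈ p^{min(m,k)}ℤ/p^k` for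
  every `k` gives `∂^{(0)}(δ̃) = ord_p δ̃_1 ≥ m` when `δ̃_1 ≠ 0`; so `∂^{(∞)}(δ̃) ≥ m`.
* **Theorem 1.9** (PDF pp. 7–8; = Thm. 1.8 of AJM 148): "Let `E` be an elliptic curve over `ℚ` and
  `p ≥ 5` a prime such that `ρ̄` is surjective and the Manin constant is prime to `p`. If
  `ord(δ̃) < ∞`, then … If we further assume the finiteness of `Ш(E/ℚ)[p^∞]`, then we have …
  (6) `length_{ℤ_p}(Ш(E/ℚ)[p^∞]) = ∂^{(ord(δ̃))}(δ̃) − ∂^{(∞)}(δ̃)`."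
* §1.3.5 (PDF p. 6): "The Manin constant is not divisible by a prime `p ≥ 3` if `E` has semi-stable
  reduction at `p` [Mazur 1978]. Thus, the Manin constant assumption is needed only when `E` has
  additive reduction at `p`." — Theorem 1.9 carries NO hypothesis on the reduction type of `E` at
  `p` (the additive case is inside its proof: Prop. 3.2, Lemma 3.10, Thm. 3.13 with the factor
  `E_p = 1` "if `p² ∣ N`", PDF pp. 15, 17–18), as recorded in the section docstring "The rank-zero
  clause at ANY prime `p ≥ 5`" of `KuriharaNumberKimShaLength` and in `ShaLengthRankZeroUpperBound`.
* Conjecture 1.10 (PDF p. 8): "`∂^{(∞)}(δ̃) = ∑_{ℓ∣N} ord_p(c_ℓ)`" — OPEN (announced equivalent to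
  Kato's main conjecture in determinant form by Castella–Sano, arXiv:2601.14504, Thm. 1, preprint
  2026); NOT used and NOT typed here.

## The fact below (weaker than print)

In analytic rank `0` (`L(E,1) ≠ 0`): `δ̃_1 = L(E,1)/Ω⁺_E ≠ 0`, `ord(δ̃) = 0 < ∞`,
`∂^{(ord(δ̃))}(δ̃) = ∂^{(0)}(δ̃) = ord_p(L(E,1)/Ω⁺_E)`. HYPOTHESIS (for a fixed `m : ℕ`): for every
`k ≥ 1`, every `n ∈ 𝒩_k` and every choice of surjective discrete logarithms
`ψ_ℓ : (ℤ/ℓ)ˣ ↠ ℤ/p^k` (`ℓ ∣ n`), `p^{min(m,k)}` divides the level-`p^k` Kurihara number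
`kuriharaNumber D.f (p^k) n ψ` in `ℤ/p^kℤ` (for `k < m` this says the number VANISHES in `ℤ/p^k`,
see `pow_min_dvd_iff_eq_zero`). By §1.5.1 (previous section) this gives `∂^{(∞)}(δ̃) ≥ m`, and
clause (6) gives `length_{ℤ_p} Ш(E/ℚ)[p^∞] = ∂^{(0)}(δ̃) − ∂^{(∞)}(δ̃) ≤ ord_p(L(E,1)/Ω⁺_E) − m`.
CONCLUSION typed: `L(E,1)/Ω(W)` is a rational `q` with `ord_p #Ш(E/ℚ)(p) + m ≤ ord_p q`.

FIDELITY NOTES. (i) The hypothesis quantifies over Kim's LITERAL `𝒩_k` (`Kato.IsKolyvaginProduct`,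
no cyclicity flag `#Ẽ(𝔽_ℓ)[p] ≤ p`): for a UNIVERSALLY quantified hypothesis the literal (larger)
index set is the weaker choice, and it stays weaker under the proof-faithful reading of the CAVEAT
in `KuriharaNumberKimStructure` (Mazur–Rubin levels only), since the literal family contains the
cyclic one; it also quantifies over ALL `ν(n)` and ALL surjective `ψ` (Kim fixes primitive roots
`η_ℓ`; `p`-divisibility of `δ̃_n` is independent of that choice — `exists_units_kuriharaNumber_eq_mul`,
file `KuriharaNumber`). (ii) NORMALISATIONS identical to the siblings ("The Lean statement and its
normalisation" in `KuriharaNumberKimCertificate`): the tree's `kuriharaNumber f (p^k) n ψ` is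
`Ω⁺_f`-normalised, Kim's `δ̃_n` is `Ω⁺_E`-normalised with `Ω⁺_E = W.realPeriodRat` for the globally
minimal `W`; the EXPLICIT period-transfer binder `Ω(W) = u·Ω⁺_{D.f}`, `u ∈ ℚ`, `|u|_p = 1` makes the
two differ by a `p`-adic unit, so membership in `p^j ℤ/p^kℤ` is the same for both. (iii) Kim's
hypothesis (ii) "Manin constant prime to `p`" is carried EXPLICITLY by a modular parametrisation
datum `D : ModularParametrizationData W N` with `p ∤ D.maninConstant` (needed exactly when `p² ∣ N`,
§1.3.5), as in every `_of_maninConstant` sibling; "finiteness of `Ш(E/ℚ)[p^∞]`" is rendered by the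
stronger binder `Finite W.sha`. (iv) NO hypothesis on the reduction type of `W` at `p` (Thm. 1.9 has
none). Weaker than print in every respect (an inequality read off an equality; period binder;
`Finite W.sha`), never stronger. No `_holds` (size XL: the whole paper — Mazur–Rubin Kolyvagin
systems, Kato's Euler system and explicit reciprocity law).

## What is NOT here (and why)

The Tamagawa input that would feed the hypothesis — "`p^{m} ∣ c_ℓ(E)` for some `ℓ ≠ p` ⇒ every
`p^t·δ̃_n^{(k)} ∈ p^{min(m,k)}ℤ/p^k`" — is NOT a printed theorem: it is a READING composed of
K. Büyükboduk, *Tamagawa defect of Euler systems*, J. Number Theory 129 (2009) 402–417 =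
arXiv:0710.3858, Cor. 3.3 with the sentence "`κ^Kato = p^α·κ^E` for some `α ≥ ord_p(c_ℓ)`"
(arXiv p. 11; `p > 3`, `ρ_{E,p^∞}` onto, ONE prime `ℓ ≠ p`, no hypothesis on the reduction at `p`)
and Kim's Thm. 3.13 "`ι∘exp*_{ω_E}∘loc^s_p(κ^Kato_n) = u·p^t·δ̃_n ∈ ℤ_p/I_nℤ_p`" (PDF p. 17;
`t` of §3.2.1). Kim's own Remark 6.2 (PDF p. 31) prints only "Kato's Kolyvagin system cannot be
primitive when `p` divides Tamagawa factors". The residual cell keeps that input as a TYPED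
Summits-side hypothesis (or files it after a referee ruling); this file vendors Kim's theorem only.

## References

* C.-H. Kim, Amer. J. Math. 148 (2026) 79–129 = arXiv:2203.12159, §1.2.2, §1.3.5, §1.4.1,
  §1.4.3–1.4.4, §1.5.1–1.5.2, Thm. 1.9 (= Thm. 1.8 of the journal version), Conj. 1.10, Prop. 3.2,
  Lemma 3.10, Thm. 3.13, Rem. 6.2. [Kim2022StructureSelmer]
* B. Mazur, Invent. Math. 44 (1978), Cor. 4.1. [Mazur1978]
-/

noncomputable section

open scoped MatrixGroups ModularForm Classical

open CongruenceSubgroup Literature.NumberTheory.EllipticCurves.ModularForms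

namespace Literature.NumberTheory.EllipticCurves.Kim2026

/-- **Kim's structure theorem, clause (6), analytic rank `0`: the upper bound from the
`p^m`-divisibility of ALL Kurihara numbers, ANY reduction type at `p` (additive included)**
(C.-H. Kim, Amer. J. Math. 148 (2026) 79–129, Thm. 1.8 = arXiv:2203.12159v4 **Thm. 1.9 (6)**, with
**§1.5.1** (`∂^{(0)}(δ̃) = ord_p δ̃_1`, `δ̃_n^{(k)} = δ̃_n mod p^k` for `n ∈ 𝒩_k`, `∂^{(i)}(δ̃^{(k)})`,
`∂^{(i)}(δ̃) = lim_k ∂^{(i)}(δ̃^{(k)})`, `∂^{(∞)}(δ̃) = min_i ∂^{(i)}(δ̃)`), §1.2.2 (`𝒫_k`, `𝒩_k`), §1.4.1,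
§1.4.3 (`δ̃_1 = [0]⁺ = L(E,1)/Ω⁺_E`), §1.4.4 (`ord(δ̃)`), §1.3.5; PDF pp. 5–8; see the module docstring
for the verbatim statements and the three-line derivation). Let `W/ℚ` be a globally minimal elliptic
curve and `p ≥ 5` a prime — NO hypothesis on the reduction of `W` at `p` — with `ρ̄_{E,p}`
surjective; let `D` be a modular parametrisation datum of `W` at level `N` whose Manin constant is
prime to `p` (Kim's hypothesis, needed exactly when `p² ∣ N`); assume `L(E,1) ≠ 0` (so
`ord(δ̃) = 0`) and `Ш(E/ℚ)` finite; assume the period transfer `Ω(W) = u·Ω⁺_{D.f}`, `u ∈ ℚ`,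
`|u|_p = 1`. Let `m : ℕ` and suppose that for every `k ≥ 1`, every `n ∈ 𝒩_k` (square-free product
of Kolyvagin primes `ℓ ∤ Np`, `ℓ ≡ 1`, `a_ℓ ≡ ℓ + 1 (mod p^k)`; `n = 1` included) and every choice of
surjective discrete logarithms `ψ_ℓ : (ℤ/ℓ)ˣ ↠ ℤ/p^k`, the Kurihara number `δ̃_n^{(k)}`
(`kuriharaNumber D.f (p^k) n ψ ∈ ℤ/p^k`) lies in `p^{min(m,k)}ℤ/p^kℤ` — whence `∂^{(i)}(δ̃) ≥ m` for
every `i ≥ 0` and `∂^{(∞)}(δ̃) ≥ m`. Then clause (6),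
`length_{ℤ_p} Ш(E/ℚ)[p^∞] = ∂^{(0)}(δ̃) − ∂^{(∞)}(δ̃)`, gives
`length_{ℤ_p} Ш(E/ℚ)[p^∞] ≤ ord_p(L(E,1)/Ω⁺_E) − m`: there is `q ∈ ℚ` with `L(E,1)/Ω(W) = q` and
`ord_p #Ш(E/ℚ)(p) + m ≤ ord_p q`. Weaker than print (inequality only; hypothesis over Kim's literal
`𝒩_k`, all `ν(n)`, all `ψ`; period binder; `Finite W.sha`), never stronger. No `_holds` (size XL).
[cite: Kim2022StructureSelmer, Thm. 1.9 (6) (PDF p. 8), §1.5.1 (PDF p. 7), §1.2.2 (PDF p. 5), §1.4.1 and §1.4.3–1.4.4 (PDF p. 7), §1.3.5 (PDF p. 6)]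
[cite: Mazur1978, Cor. 4.1] -/
def rankZero_padicValNat_sha_add_le_of_forall_pow_dvd_kuriharaNumber : Prop :=
  ∀ (W : WeierstrassCurve ℚ) [W.IsElliptic] [W.IsGloballyMinimal] (p : ℕ) [Fact p.Prime],
    5 ≤ p → W.HasSurjectiveModNGaloisRep p →
    W.entireLFunction 1 ≠ 0 → Finite W.sha →
    ∀ {N : ℕ} [NeZero N] (D : ModularParametrizationData W N),
    ¬ (p : ℤ) ∣ D.maninConstant →
    (∃ u : ℚ, ‖(u : ℚ_[p])‖ = 1 ∧ W.realPeriodRat = u * plusPeriod D.f) →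
    ∀ m : ℕ,
    (∀ k : ℕ, 1 ≤ k → ∀ (n : ℕ) [NeZero n], Kato.IsKolyvaginProduct W p k n →
      ∀ ψ : (ℓ : ℕ) → (ZMod ℓ)ˣ →* Multiplicative (ZMod (p ^ k)),
        (∀ ℓ ∈ n.primeFactors, Function.Surjective (ψ ℓ)) →
        ((p ^ min m k : ℕ) : ZMod (p ^ k)) ∣ kuriharaNumber D.f (p ^ k) n ψ) →
    ∃ q : ℚ, W.entireLFunction 1 / (W.realPeriodRat : ℂ) = (q : ℂ) ∧
      (padicValNat p (Nat.card (AddCommGroup.primaryComponent W.sha p)) : ℤ) + m ≤ padicValRat p q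

/-- The divisibility convention of the hypothesis at a level `k ≤ m`: in `ℤ/p^kℤ` the element
`p^{min(m,k)} = p^k = 0`, and `0 ∣ x ↔ x = 0`, so "`δ̃_n^{(k)} ∈ p^{min(m,k)}ℤ/p^k`" says that the
level-`p^k` Kurihara number VANISHES — Kim's `δ̃_n^{(k)} ∈ p^j ℤ/p^kℤ` with `j ≥ k`, §1.5.1.
[cite: Kim2022StructureSelmer, §1.5.1 (PDF p. 7)] -/
theorem pow_min_dvd_iff_eq_zero {p m k : ℕ} (hk : k ≤ m) (x : ZMod (p ^ k)) :
    ((p ^ min m k : ℕ) : ZMod (p ^ k)) ∣ x ↔ x = 0 := by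
  rw [min_eq_right hk, ZMod.natCast_self, zero_dvd_iff]

/-- **Consistency with the certificate-free sibling (A161).** At `m = 0` the divisibility
hypothesis of `rankZero_padicValNat_sha_add_le_of_forall_pow_dvd_kuriharaNumber` is vacuous
(`p^{min(0,k)} = 1` divides everything), and the fact returns the conclusion of
`Kim2026.rankZero_padicValNat_sha_le_of_maninConstant` (file `ShaLengthRankZeroUpperBound`),
`ord_p #Ш(E/ℚ)(p) ≤ ord_p(L(E,1)/Ω(W))` — under the present fact's extra period-transfer binder,
which the sibling does not carry. [cite: Kim2022StructureSelmer, Thm. 1.9 (6) (PDF p. 8), §1.5.1 (PDF p. 7)] -/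
theorem rankZero_padicValNat_sha_le_of_kuriharaDivisibilityBound
    (h : rankZero_padicValNat_sha_add_le_of_forall_pow_dvd_kuriharaNumber)
    (W : WeierstrassCurve ℚ) [W.IsElliptic] [W.IsGloballyMinimal] (p : ℕ) [Fact p.Prime]
    (hp : 5 ≤ p) (hsurj : W.HasSurjectiveModNGaloisRep p)
    (hL : W.entireLFunction 1 ≠ 0) (hfin : Finite W.sha)
    {N : ℕ} [NeZero N] (D : ModularParametrizationData W N)
    (hc : ¬ (p : ℤ) ∣ D.maninConstant)
    (hu : ∃ u : ℚ, ‖(u : ℚ_[p])‖ = 1 ∧ W.realPeriodRat = u * plusPeriod D.f) :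
    ∃ q : ℚ, W.entireLFunction 1 / (W.realPeriodRat : ℂ) = (q : ℂ) ∧
      (padicValNat p (Nat.card (AddCommGroup.primaryComponent W.sha p)) : ℤ) ≤ padicValRat p q := by
  obtain ⟨q, hq, hle⟩ := h W p hp hsurj hL hfin D hc hu 0 (fun k _ n _ _ ψ _ => by
    rw [Nat.zero_min, pow_zero, Nat.cast_one]; exact one_dvd _)
  exact ⟨q, hq, by simpa using hle⟩

/-! ### APPEND (harvest seat 2, GEN 30, E67b): level reduction of Kurihara numbers and the bridge
from the divisibility predicate `KuriharaDivisibleAt` (file `KuriharaNumberInvariants`)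

Kim §1.4.3 / §1.5.1 write `δ̃_n ∈ ℤ_p/I_nℤ_p` and `δ̃_n^{(k)} = δ̃_n mod p^k ∈ ℤ/p^kℤ` for `n ∈ 𝒩_k`:
the level-`p^k` numbers are the reductions of ONE `p`-adic quantity, so for `j ≤ k` the level-`p^j`
number is the reduction of the level-`p^k` one. In the tree the Kurihara number is DEFINED at each
modulus separately (`kuriharaNumber f (p^k) n ψ`, with `ψ` valued in `ℤ/p^k`), so this compatibility
is a lemma: `castHom_kuriharaNumber` below (the discrete logarithms are reduced along with the
modulus; the symbols `[a/n]⁺_f` must be `p`-integral, which they are for the newform of an elliptic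
curve with `E[p]` irreducible at levels prime to `N`, `IsNewformOf.not_dvd_den_ratPlusSymbol_div`).
With it, the hypothesis of `rankZero_padicValNat_sha_add_le_of_forall_pow_dvd_kuriharaNumber` at `m`
is implied by "`KuriharaDivisibleAt W p D.f n m` for EVERY `n`" (the predicate of
`KuriharaNumberInvariants`, which says: the level-`p^k` number vanishes for every `k ≤ m` with
`n ∈ 𝒩_k`) — `rankZero_padicValNat_sha_add_le_of_forall_kuriharaDivisibleAt`. NOTE the index set:
ALL `n` (Kim's literal `𝒩_k`), not only the cyclic levels over which `kuriharaPartial` /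
`kuriharaPartialInfty` of that file take their infimum. -/

section LevelReduction

open Literature.NumberTheory.EllipticCurves
open Literature.NumberTheory.DiophantineGeometry.Dioph (ratModP)

variable {N : ℕ} (f : CuspForm (Gamma0 N) 2)

/-- Reduction of `ratModP` along `ℤ/m → ℤ/d` (`d ∣ m`) for a rational with denominator prime to `m`:
both are "numerator times the inverse of the denominator", and a ring map sends the inverse of a
unit to the inverse of its image. [cite: Kim2022StructureSelmer, §1.4.3 and §1.5.1 (PDF p. 7)] -/
theorem castHom_ratModP {m d : ℕ} (h : d ∣ m) {q : ℚ} (hq : q.den.Coprime m) :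
    ZMod.castHom h (ZMod d) (ratModP m q) = ratModP d q := by
  rw [ratModP_def, ratModP_def, map_mul, map_intCast]
  congr 1
  set φ := ZMod.castHom h (ZMod d)
  have hm : (q.den : ZMod m) * (q.den : ZMod m)⁻¹ = 1 := ZMod.coe_mul_inv_eq_one q.den hq
  have hd : (q.den : ZMod d) * (q.den : ZMod d)⁻¹ = 1 :=
    ZMod.coe_mul_inv_eq_one q.den (Nat.Coprime.coprime_dvd_right h hq)
  have h1 : (q.den : ZMod d) * φ ((q.den : ZMod m)⁻¹) = 1 := by
    have := congrArg φ hm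
    rwa [map_mul, map_natCast, map_one] at this
  calc φ ((q.den : ZMod m)⁻¹)
      = ((q.den : ZMod d)⁻¹ * (q.den : ZMod d)) * φ ((q.den : ZMod m)⁻¹) := by
          rw [mul_comm ((q.den : ZMod d)⁻¹), hd, one_mul]
    _ = (q.den : ZMod d)⁻¹ := by rw [mul_assoc, h1, mul_one]

/-- The discrete logarithms reduced along `ℤ/p^k → ℤ/d`. [cite: Kim2022StructureSelmer, §1.4.3 (PDF p. 7)] -/
def reduceLog {m d : ℕ} (h : d ∣ m) (ψ : (ℓ : ℕ) → (ZMod ℓ)ˣ →* Multiplicative (ZMod m))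
    (ℓ : ℕ) : (ZMod ℓ)ˣ →* Multiplicative (ZMod d) :=
  (AddMonoidHom.toMultiplicative (ZMod.castHom h (ZMod d)).toAddMonoidHom).comp (ψ ℓ)

/-- Unfolding `reduceLog`: the reduced logarithm is the old one followed by `ℤ/m → ℤ/d`.
[cite: Kim2022StructureSelmer, §1.4.3 (PDF p. 7)] -/
@[simp] theorem toAdd_reduceLog_apply {m d : ℕ} (h : d ∣ m)
    (ψ : (ℓ : ℕ) → (ZMod ℓ)ˣ →* Multiplicative (ZMod m)) (ℓ : ℕ) (u : (ZMod ℓ)ˣ) :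
    Multiplicative.toAdd (reduceLog h ψ ℓ u) =
      ZMod.castHom h (ZMod d) (Multiplicative.toAdd (ψ ℓ u)) := rfl

/-- Surjectivity is preserved under reduction of the discrete logarithms.
[cite: Kim2022StructureSelmer, §1.4.3 (PDF p. 7)] -/
theorem reduceLog_surjective {m d : ℕ} (h : d ∣ m)
    {ψ : (ℓ : ℕ) → (ZMod ℓ)ˣ →* Multiplicative (ZMod m)} {ℓ : ℕ}
    (hψ : Function.Surjective (ψ ℓ)) : Function.Surjective (reduceLog h ψ ℓ) := by
  intro y
  obtain ⟨x, hx⟩ := ZMod.castHom_surjective h (Multiplicative.toAdd y)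
  obtain ⟨u, hu⟩ := hψ (Multiplicative.ofAdd x)
  refine ⟨u, ?_⟩
  apply Multiplicative.toAdd.injective
  rw [toAdd_reduceLog_apply, hu, toAdd_ofAdd, hx]

/-- **Level reduction of Kurihara numbers** (`δ̃_n^{(j)} = δ̃_n^{(k)} mod p^j` for `j ≤ k`, Kim §1.4.3
"`δ̃_n ∈ ℤ_p/I_nℤ_p`", §1.5.1 "`δ̃^{(k)}_n = δ̃_n mod p^k`"): for `d ∣ m` and `p`-integral symbols
`[a/n]⁺_f` (denominators prime to `m`), the image of `kuriharaNumber f m n ψ` under `ℤ/m → ℤ/d` is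
`kuriharaNumber f d n (reduceLog ψ)`. [cite: Kim2022StructureSelmer, §1.4.3 and §1.5.1 (PDF p. 7)] -/
theorem castHom_kuriharaNumber {m d : ℕ} (h : d ∣ m) (n : ℕ) [NeZero n]
    (ψ : (ℓ : ℕ) → (ZMod ℓ)ˣ →* Multiplicative (ZMod m))
    (hden : ∀ a : ℕ, (ratPlusSymbol f ((a : ℚ) / n)).den.Coprime m) :
    ZMod.castHom h (ZMod d) (kuriharaNumber f m n ψ) = kuriharaNumber f d n (reduceLog h ψ) := by
  rw [kuriharaNumber_def, kuriharaNumber_def, map_sum]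
  refine Finset.sum_congr rfl fun a _ => ?_
  rw [map_mul, map_prod, castHom_ratModP h (hden _)]
  simp only [toAdd_reduceLog_apply]

end LevelReduction

section Bridge

open Literature.NumberTheory.EllipticCurves

/-- Kernel of `ℤ/p^k → ℤ/p^j`: an element mapping to `0` is a multiple of `p^j`.
[cite: Kim2022StructureSelmer, §1.5.1 (PDF p. 7)] -/
theorem pow_dvd_of_castHom_eq_zero {p k j : ℕ} [Fact p.Prime] (h : p ^ j ∣ p ^ k)
    (x : ZMod (p ^ k)) (hx : ZMod.castHom h (ZMod (p ^ j)) x = 0) :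
    ((p ^ j : ℕ) : ZMod (p ^ k)) ∣ x := by
  haveI : NeZero (p ^ k) := ⟨pow_ne_zero k (Fact.out : p.Prime).ne_zero⟩
  rw [← ZMod.natCast_zmod_val x, map_natCast, ZMod.natCast_eq_zero_iff] at hx
  obtain ⟨c, hc⟩ := hx
  rw [← ZMod.natCast_zmod_val x, hc, Nat.cast_mul]
  exact Dvd.intro _ rfl

/-- **Per-level form of the bridge**: at a level `n ∈ 𝒩_k` (`k ≥ 1`) prime to the conductor `= N`,
with `E[p]` irreducible (`p` odd), `KuriharaDivisibleAt W p D.f n m` gives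
`p^{min(m,k)} ∣ kuriharaNumber D.f (p^k) n ψ` for every surjective `ψ`: at `k ≤ m` the number
vanishes; at `k > m` reduce to the level `m` (`castHom_kuriharaNumber`), where it vanishes.
[cite: Kim2022StructureSelmer, §1.4.3 and §1.5.1 (PDF p. 7)] -/
theorem pow_min_dvd_kuriharaNumber_of_kuriharaDivisibleAt
    (W : WeierstrassCurve ℚ) [W.IsElliptic] [W.IsGloballyMinimal] (p : ℕ) [Fact p.Prime]
    (hp2 : p ≠ 2) (hirr : W.HasIrreducibleModPGaloisRep p)
    {N : ℕ} [NeZero N] (D : ModularParametrizationData W N) (hN : W.conductorNorm ℤ = N)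
    {m k : ℕ} {n : ℕ} [NeZero n] (hn : Kato.IsKolyvaginProduct W p k n)
    (hdiv : KuriharaDivisibleAt W p D.f n m)
    (ψ : (ℓ : ℕ) → (ZMod ℓ)ˣ →* Multiplicative (ZMod (p ^ k)))
    (hψ : ∀ ℓ ∈ n.primeFactors, Function.Surjective (ψ ℓ)) :
    ((p ^ min m k : ℕ) : ZMod (p ^ k)) ∣ kuriharaNumber D.f (p ^ k) n ψ := by
  by_cases hkm : k ≤ m
  · -- low level: the number itself vanishes
    have h0 : kuriharaNumber D.f (p ^ k) n ψ = 0 := hdiv k hkm hn ψ hψ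
    rw [h0]
    exact dvd_zero _
  · -- high level: reduce to the level `m`, where the number vanishes
    push Not at hkm
    rw [min_eq_left hkm.le]
    have hdvd : p ^ m ∣ p ^ k := pow_dvd_pow p hkm.le
    have hnm : Kato.IsKolyvaginProduct W p m n := hn.mono hkm.le
    have hcopN : n.Coprime N := by
      have := hn.coprime
      rw [hN] at this
      exact Nat.Coprime.coprime_dvd_right (dvd_mul_right N p) this
    have hden : ∀ a : ℕ, (ratPlusSymbol D.f ((a : ℚ) / n)).den.Coprime (p ^ k) := by
      intro a
      have hnd := D.isNewformOf.not_dvd_den_ratPlusSymbol_div hp2 hirr hcopN (a : ℤ)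
      rw [Int.cast_natCast] at hnd
      exact Nat.Coprime.pow_right k
        (Nat.coprime_comm.mp ((Nat.Prime.coprime_iff_not_dvd Fact.out).mpr hnd))
    have h0 : kuriharaNumber D.f (p ^ m) n (reduceLog hdvd ψ) = 0 :=
      hdiv m le_rfl hnm _ fun ℓ hℓ => reduceLog_surjective hdvd (hψ ℓ hℓ)
    rw [← castHom_kuriharaNumber D.f hdvd n ψ hden] at h0
    exact pow_dvd_of_castHom_eq_zero hdvd _ h0

/-- **Bridge**: the hypothesis of `rankZero_padicValNat_sha_add_le_of_forall_pow_dvd_kuriharaNumber`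
at `m` follows from `KuriharaDivisibleAt W p D.f n m` for EVERY `n` (file `KuriharaNumberInvariants`:
"for every `k ≤ m` with `n ∈ 𝒩_k` and every surjective `ψ`, `kuriharaNumber D.f (p^k) n ψ = 0`"),
by level reduction (`castHom_kuriharaNumber`) at the levels `k > m`; hence the fact's conclusion
`ord_p #Ш(E/ℚ)(p) + m ≤ ord_p(L(E,1)/Ω(W))`. The symbols are `p`-integral because `E[p]` is
irreducible (`ρ̄` onto) and Kolyvagin levels are prime to the conductor `= N` (hypothesis `hN`:
the datum's level is the conductor). [cite: Kim2022StructureSelmer, Thm. 1.9 (6) (PDF p. 8), §1.5.1 (PDF p. 7), §1.4.1 and §1.4.3 (PDF p. 7)] -/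
theorem rankZero_padicValNat_sha_add_le_of_forall_kuriharaDivisibleAt
    (h : rankZero_padicValNat_sha_add_le_of_forall_pow_dvd_kuriharaNumber)
    (W : WeierstrassCurve ℚ) [W.IsElliptic] [W.IsGloballyMinimal] (p : ℕ) [Fact p.Prime]
    (hp : 5 ≤ p) (hsurj : W.HasSurjectiveModNGaloisRep p)
    (hL : W.entireLFunction 1 ≠ 0) (hfin : Finite W.sha)
    {N : ℕ} [NeZero N] (D : ModularParametrizationData W N)
    (hc : ¬ (p : ℤ) ∣ D.maninConstant)
    (hu : ∃ u : ℚ, ‖(u : ℚ_[p])‖ = 1 ∧ W.realPeriodRat = u * plusPeriod D.f)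
    (hN : W.conductorNorm ℤ = N) (m : ℕ)
    (hdiv : ∀ n : ℕ, KuriharaDivisibleAt W p D.f n m) :
    ∃ q : ℚ, W.entireLFunction 1 / (W.realPeriodRat : ℂ) = (q : ℂ) ∧
      (padicValNat p (Nat.card (AddCommGroup.primaryComponent W.sha p)) : ℤ) + m ≤ padicValRat p q :=
  have hp2 : p ≠ 2 := by omega
  h W p hp hsurj hL hfin D hc hu m fun _ _ n _ hn ψ hψ =>
    pow_min_dvd_kuriharaNumber_of_kuriharaDivisibleAt W p hp2
      (hasIrreducibleModPGaloisRep_of_hasSurjectiveModNGaloisRep W p hsurj) D hN hn (hdiv n) ψ hψ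

end Bridge

/-! ### APPEND (harvest seat 2, GEN 30, E67c): the same clause over the CYCLIC (Mazur–Rubin) levels —
the proof-faithful reading of Thm. 1.8 (6) — and its bridge from `kuriharaPartialInfty`

WHY A SECOND FACT. The fact `rankZero_padicValNat_sha_add_le_of_forall_pow_dvd_kuriharaNumber` above
quantifies its divisibility hypothesis over Kim's LITERAL `𝒩_k` and is therefore weaker than print
under EVERY reading of §1.5.1. The fact below restricts the hypothesis to the CYCLIC levels — the
levels `n ∈ 𝒩_k` all of whose primes `ℓ` have `#Ẽ(𝔽_ℓ)[p] ≤ p`, i.e. `T/(Fr_ℓ − 1)T` cyclic — and is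
weaker than print ONLY under the proof-faithful reading recorded in the CAVEAT of
`KuriharaNumberKimStructure` and adopted by `KuriharaNumberInvariants` (`IsCyclicKolyvaginLevel`,
`kuriharaPartial`, `kuriharaPartialInfty`): Kim's Kolyvagin systems, and hence every `∂^{(i)}`,
`∂^{(∞)}` appearing in the PROOF of Thm. 1.9 (§§2–5), live on the square-free products of a prime
set `𝒫` satisfying the hypothesis of his Thm. 2.1 (Mazur–Rubin) — verbatim (arXiv v4 PDF p. 12,
p0012 L57): "`T/(Fr_ℓ − 1)T` is a cyclic `ℤ_p`-module for every `ℓ ∈ 𝒫`" — followed by (§2.2.3)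
"Under our working hypotheses, all the conditions in Theorem 2.1 below are satisfied." For the
LITERAL `𝒫_1` of §1.2.2 this last sentence fails on a set of primes of positive density: if
`Fr_ℓ = 1` in `Gal(ℚ(E[p^k])/ℚ)` then `ℓ ≡ det Fr_ℓ = 1`, `a_ℓ ≡ tr Fr_ℓ = 2 ≡ ℓ + 1 (mod p^k)`, so
`ℓ ∈ 𝒫_k`, while `T/(Fr_ℓ − 1)T ↠ (ℤ/p^k)²` is not cyclic (equivalently `E[p] ⊂ Ẽ(𝔽_ℓ)`,
`#Ẽ(𝔽_ℓ)[p] = p²`). The consistent reading of the PROOF is therefore `𝒫 := 𝒫_1 ∩ {cyclic}` — the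
practice of the field: Büyükboduk, *Λ-adic Kolyvagin systems*, IMRN 2011 = arXiv:0706.0377 §3
chooses `𝒫_{k,m} := {ℓ : Fr_ℓ conjugate to τ in Gal(ℚ(T/p^{k+m}T, μ_{p^{k+m+1}})/ℚ)}` "so that
`T_{k,m}/(Fr_ℓ − 1)T_{k,m}` is free of rank one" (Lemma 6); Büyükboduk JNT 129 (2009) hypothesis H5
and Remark 1 "the choice of the set of primes `𝒫` which satisfies H5 has been explained"; Kurihara,
Münster J. Math. 7 (2014) §3.1 `𝒫_1^{(N)}`; Castella–Sano arXiv:2601.14504 Prop. 2.1.5 (the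
divisibility index `𝓜_∞` is unchanged under shrinking the prime set to `𝓛^{(m)}`). Under the
LITERAL reading of the STATEMENT of Thm. 1.9 the fact below is NOT weaker than print (the literal
`∂^{(∞)}` is an infimum over more levels, hence `≤` the cyclic one). It is filed with this flag
(`Kim2026-(6)-cyclic-reading`) so that the residual cell's referee can rule which reading is the
statement of record; its consumers are the kernel syntheses of the (6)-EQUALITY at `p ≥ 5` from the
two directions (`Kim2026.rankZero_le_padicValNat_sha_of_kuriharaNumber_ne_zero`, file
`ShaLengthRankZeroLowerBound`, carries the same cyclicity flag). -/

section CyclicLevels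

open Literature.NumberTheory.EllipticCurves

/-- **Kim's structure theorem, clause (6), analytic rank `0`: the upper bound from the
`p^m`-divisibility of the Kurihara numbers at all CYCLIC (Mazur–Rubin) levels — the proof-faithful
reading** (C.-H. Kim, Amer. J. Math. 148 (2026) 79–129, Thm. 1.8 = arXiv:2203.12159v4 **Thm. 1.9 (6)**
with §1.5.1, §1.2.2 and **Thm. 2.1 / §2.2.3** (PDF p. 12: "`T/(Fr_ℓ − 1)T` is a cyclic `ℤ_p`-module for
every `ℓ ∈ 𝒫` … Under our working hypotheses, all the conditions in Theorem 2.1 below are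
satisfied"), §1.4.1, §1.4.3–1.4.4, §1.3.5; see the section docstring above for why the Kolyvagin
levels of the PROOF are the cyclic ones and for the flag this fact carries). Statement: as
`rankZero_padicValNat_sha_add_le_of_forall_pow_dvd_kuriharaNumber`, except that the divisibility
`δ̃_n^{(k)} ∈ p^{min(m,k)}ℤ/p^k` is required only at levels `n ∈ 𝒩_k` all of whose prime factors `ℓ`
satisfy the cyclicity condition `#Ẽ(𝔽_ℓ)[p] ≤ p` (spelled exactly as in the siblings
`Kim2022_rankZero_…_of_maninConstant` and `IsCyclicKolyvaginLevel`); conclusion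
`ord_p #Ш(E/ℚ)(p) + m ≤ ord_p(L(E,1)/Ω(W))`. Weaker than what the source PROVES; NOT weaker than
the literal print of §1.2.2/§1.5.1 — flag `Kim2026-(6)-cyclic-reading` (referee to rule). No
`_holds` (size XL).
[cite: Kim2022StructureSelmer, Thm. 1.9 (6) (PDF p. 8), §1.5.1 (PDF p. 7), Thm. 2.1 and §2.2.3 (PDF p. 12), §1.2.2 (PDF p. 5), §1.4.1 and §1.4.3–1.4.4 (PDF p. 7), §1.3.5 (PDF p. 6)]
[cite: Mazur1978, Cor. 4.1] -/
def rankZero_padicValNat_sha_add_le_of_forall_pow_dvd_kuriharaNumber_cyclicLevel : Prop :=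
  ∀ (W : WeierstrassCurve ℚ) [W.IsElliptic] [W.IsGloballyMinimal] (p : ℕ) [Fact p.Prime],
    5 ≤ p → W.HasSurjectiveModNGaloisRep p →
    W.entireLFunction 1 ≠ 0 → Finite W.sha →
    ∀ {N : ℕ} [NeZero N] (D : ModularParametrizationData W N),
    ¬ (p : ℤ) ∣ D.maninConstant →
    (∃ u : ℚ, ‖(u : ℚ_[p])‖ = 1 ∧ W.realPeriodRat = u * plusPeriod D.f) →
    ∀ m : ℕ,
    (∀ k : ℕ, 1 ≤ k → ∀ (n : ℕ) [NeZero n], Kato.IsKolyvaginProduct W p k n →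
      (∀ (ℓ : ℕ) [Fact ℓ.Prime], ℓ ∣ n →
        Nat.card {P : ((WeierstrassCurve.integralModelInt W).map
            (Int.castRingHom (ZMod ℓ))).toAffine.Point // p • P = 0} ≤ p) →
      ∀ ψ : (ℓ : ℕ) → (ZMod ℓ)ˣ →* Multiplicative (ZMod (p ^ k)),
        (∀ ℓ ∈ n.primeFactors, Function.Surjective (ψ ℓ)) →
        ((p ^ min m k : ℕ) : ZMod (p ^ k)) ∣ kuriharaNumber D.f (p ^ k) n ψ) →
    ∃ q : ℚ, W.entireLFunction 1 / (W.realPeriodRat : ℂ) = (q : ℂ) ∧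
      (padicValNat p (Nat.card (AddCommGroup.primaryComponent W.sha p)) : ℤ) + m ≤ padicValRat p q

/-- The cyclic-level fact implies the literal-level fact (its hypothesis asks for less).
[cite: Kim2022StructureSelmer, Thm. 1.9 (6) (PDF p. 8), §1.5.1 (PDF p. 7)] -/
theorem rankZero_padicValNat_sha_add_le_of_forall_pow_dvd_kuriharaNumber_of_cyclicLevel
    (h : rankZero_padicValNat_sha_add_le_of_forall_pow_dvd_kuriharaNumber_cyclicLevel) :
    rankZero_padicValNat_sha_add_le_of_forall_pow_dvd_kuriharaNumber :=
  fun W _ _ p _ hp hsurj hL hfin _ _ D hc hu m hdiv =>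
    h W p hp hsurj hL hfin D hc hu m fun k hk n _ hn _ ψ hψ => hdiv k hk n hn ψ hψ

/-- Unwinding the divisibility index: `m ≤ kuriharaDivIndex W p f n` (an `ℕ∞` supremum) gives the
divisibility predicate at `m` itself (the predicate is antitone in the exponent).
[cite: Kim2022StructureSelmer, §1.5.1 (PDF p. 7), Def. 2.13 (PDF p. 14)] -/
theorem kuriharaDivisibleAt_of_le_kuriharaDivIndex (W : WeierstrassCurve ℚ) [W.IsGloballyMinimal]
    (p : ℕ) {N : ℕ} (f : CuspForm (Gamma0 N) 2) {n m : ℕ}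
    (hm : (m : ℕ∞) ≤ kuriharaDivIndex W p f n) : KuriharaDivisibleAt W p f n m := by
  by_contra hnot
  rcases Nat.eq_zero_or_pos m with rfl | hmpos
  · exact hnot (kuriharaDivisibleAt_zero W p f n)
  · have hle : kuriharaDivIndex W p f n ≤ ((m - 1 : ℕ) : ℕ∞) := by
      rw [kuriharaDivIndex_def]
      refine iSup₂_le fun j hj => ?_
      have hjm : j < m := by
        by_contra hjm
        exact hnot (hj.anti (not_lt.mp hjm))
      exact_mod_cast Nat.le_sub_one_of_lt hjm
    have := hm.trans hle
    have h' : (m : ℕ∞) ≤ ((m - 1 : ℕ) : ℕ∞) := this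
    rw [ENat.coe_le_coe] at h'
    omega

/-- `m ≤ ∂^{(∞)}(δ̃)` (cc-typer-1's `kuriharaPartialInfty`, cyclic levels) gives `p^m ∣ δ̃_n` at every
cyclic level `n`. [cite: Kim2022StructureSelmer, §1.5.1 (PDF p. 7)] -/
theorem kuriharaDivisibleAt_of_le_kuriharaPartialInfty (W : WeierstrassCurve ℚ) [W.IsGloballyMinimal]
    (p : ℕ) {N : ℕ} (f : CuspForm (Gamma0 N) 2) {m : ℕ}
    (hm : (m : ℕ∞) ≤ kuriharaPartialInfty W p f) {n : ℕ} (hn : IsCyclicKolyvaginLevel W p n) :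
    KuriharaDivisibleAt W p f n m :=
  kuriharaDivisibleAt_of_le_kuriharaDivIndex W p f
    ((hm.trans (kuriharaPartialInfty_le W p f _)).trans (kuriharaPartial_le W p f hn rfl))

/-- **Bridge (cyclic reading)**: `m ≤ kuriharaPartialInfty W p D.f` — i.e. `∂^{(∞)}(δ̃) ≥ m` over the
cyclic levels, in the vocabulary of `KuriharaNumberInvariants` — feeds the cyclic-level fact, hence
`ord_p #Ш(E/ℚ)(p) + m ≤ ord_p(L(E,1)/Ω(W))`. With n1011's ∃-certificate LOWER fact this is the
kernel route to the (6)-EQUALITY predicates at `p ≥ 5` (under the cyclic reading).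
[cite: Kim2022StructureSelmer, Thm. 1.9 (6) (PDF p. 8), §1.5.1 (PDF p. 7), Thm. 2.1 (PDF p. 12)] -/
theorem rankZero_padicValNat_sha_add_le_of_le_kuriharaPartialInfty
    (h : rankZero_padicValNat_sha_add_le_of_forall_pow_dvd_kuriharaNumber_cyclicLevel)
    (W : WeierstrassCurve ℚ) [W.IsElliptic] [W.IsGloballyMinimal] (p : ℕ) [Fact p.Prime]
    (hp : 5 ≤ p) (hsurj : W.HasSurjectiveModNGaloisRep p)
    (hL : W.entireLFunction 1 ≠ 0) (hfin : Finite W.sha)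
    {N : ℕ} [NeZero N] (D : ModularParametrizationData W N)
    (hc : ¬ (p : ℤ) ∣ D.maninConstant)
    (hu : ∃ u : ℚ, ‖(u : ℚ_[p])‖ = 1 ∧ W.realPeriodRat = u * plusPeriod D.f)
    (hN : W.conductorNorm ℤ = N) (m : ℕ)
    (hm : (m : ℕ∞) ≤ kuriharaPartialInfty W p D.f) :
    ∃ q : ℚ, W.entireLFunction 1 / (W.realPeriodRat : ℂ) = (q : ℂ) ∧
      (padicValNat p (Nat.card (AddCommGroup.primaryComponent W.sha p)) : ℤ) + m ≤ padicValRat p q :=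
  have hp2 : p ≠ 2 := by omega
  h W p hp hsurj hL hfin D hc hu m fun _ hk n _ hn hcyc ψ hψ =>
    pow_min_dvd_kuriharaNumber_of_kuriharaDivisibleAt W p hp2
      (hasIrreducibleModPGaloisRep_of_hasSurjectiveModNGaloisRep W p hsurj) D hN hn
      (kuriharaDivisibleAt_of_le_kuriharaPartialInfty W p D.f hm ⟨hn.mono hk, hcyc⟩) ψ hψ

end CyclicLevels

end Literature.NumberTheory.EllipticCurves.Kim2026

end
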